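import Mathlib.Data.ZMod.Defs
import Mathlib.Algebra.BigOperators.Fin
import Mathlib.Data.Fin.VecNotation
import Literature.Computability.MetaComplexity.Frege
import HarnessLib

/-!
# Frege systems with modular counting connectives (`AC⁰[p]`-Frege, `F_d(MOD_p)`)

Trunk T-CPLX-META (Literature/Computability/MetaComplexity); definition request
`defn-AC0pFregeIsPolyBounded` (route PneNP/proofcplx: the rung "superpolynomial lower bounds
for constant-depth Frege with `MOD_p` gates", open since Krajíček 1995 / Buss et al. 1997,
between bounded-depth Frege (known) and Frege).

Following Buss–Impagliazzo–Krajíček–Pudlák–Razborov–Sgall (Def. 1.1), who follow Krajíček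
(1995, §12.6): for a fixed modulus `a`, the propositional language is extended by connectives
`MOD_{a,i}` (`i ∈ ℤ/a`) of *unbounded arity*, `MOD_{a,i}(φ₁, …, φ_k)` being true iff
`#{j : φ_j true} ≡ i (mod a)`; a Frege system `F` (schematic rules over `¬, ∧, ∨`, instantiated
now by formulas of the extended language) is augmented by the `MOD_a` axioms
1. `MOD_{a,0}(∅)`,
2. `¬ MOD_{a,i}(∅)` for `i ≠ 0`,
3. `MOD_{a,i}(φ₁, …, φ_k, φ_{k+1}) ≡ [(MOD_{a,i}(φ₁, …, φ_k) ∧ ¬φ_{k+1}) ∨ (MOD_{a,i-1}(φ₁, …, φ_k) ∧ φ_{k+1})]`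
   (`i - 1` taken modulo `a`),
giving the system `F(MOD_a)`; its depth-`d` subsystem `F_d(MOD_a)` allows only lines of depth
`≤ d`, where a `MOD` gate adds one to the depth. For `a = p` prime these are the
`AC⁰[p]`-Frege systems.

## Contents

* `Literature.Computability.Complexity.PropForm.ofDNF` — a clause list read as a DNF formula (the standard target
  class of tautologies for lower bounds: DNF tautologies = negations of unsatisfiable CNFs).
* `Literature.CplxMeta.PropFormMod a ν` — formulas over `¬, ∧, ∨, MOD_{a,i}`; `eval`, `size`, `subst`,
  `altDepth`, the embedding `ofPropForm` of `¬∧∨`-formulas, and `IsModAxiom` (the `MOD_a`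
  axioms, proved sound: `IsModAxiom.isTautology`).
* `FregeSystem.IsModDerivation / IsModProofOf / IsModDepthProofOf`, `modProofSize`,
  `FregeSystem.IsModDepthPolyBoundedOn F a d T` (depth-`d` `F(MOD_a)` proves the tautologies
  in the target class `T ⊆ PropForm ℕ` in polynomial size), and the requested predicate
  `AC0pFregeIsPolyBounded p d`.
* API: `MOD_a` axioms are tautologies; an `F`-proof (of depth `d`) embeds as an
  `F(MOD_a)`-proof (of depth `d`); soundness of `F(MOD_a)` for sound `F`.

## Sources

* S. Buss, R. Impagliazzo, J. Krajíček, P. Pudlák, A. A. Razborov, J. Sgall, *Proof complexity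
  in algebraic systems and bounded depth Frege systems with modular counting*,
  Comput. Complexity 6 (1996/97) 256–298: Def. 1.1 (the connectives `MOD_{a,i}`, the `MOD_a`
  axioms 1–3, the system `F(MOD_a)`, depth of a formula and of a proof, size of a proof).
* J. Krajíček, *Bounded arithmetic, propositional logic, and complexity theory* (CUP 1995),
  §12.6 (`F(MOD_p)`), §4.3 (depth).

## Design choices

* Arguments of a `MOD` gate are a `Fin k`-indexed family (`modc (i : ZMod a) (args : Fin k → _)`),
  as in Mathlib's `FirstOrder.Language.Term.func`; the residue `i` lives in `ZMod a` so that
  axiom 3's `i - 1 (mod a)` is literal subtraction and no `NeZero a` hypothesis is needed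
  (`a = 0, 1` are degenerate but harmless; the intended use has `a` prime).
* Binary `∧, ∨` with *alternation depth* exactly as `PropForm.altDepth` in `Frege.lean`
  (Krajíček's depth), extended by: a `MOD` gate always adds `1` and its arguments start new
  blocks (Buss et al. Def. 1.1, clause 3 of the depth definition). This differs from Buss et
  al.'s literal clauses only in that they count every `¬` and treat `∧` as an abbreviation;
  the two depth measures agree up to the usual constant-factor/double-negation conventions,
  which do not affect "for every constant `d`" statements.
* Frege rules stay those of a `FregeSystem` over `PropForm ℕ` (`Frege.lean`); their
  metavariables are instantiated by `PropFormMod` formulas via `ofPropForm` + `subst`. The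
  `MOD_a` axioms have a *sequence* metavariable and so are a predicate `IsModAxiom`, not
  finitely many `FregeRule`s.
* Proof size is the symbol count `modProofSize` (sum of `size` of the lines), as `proofSize` in
  `Frege.lean`; Buss et al. count inferences, which is bounded by the symbol count (they note
  lower bounds transfer).
* **Non-vacuity of the requested predicate.** "Every tautology has a depth-`d` proof" is false
  for trivial reasons (a tautology of depth `> d` has no depth-`d` proof, being itself a line),
  so polynomial boundedness of a depth-`d` system must be relative to a target class of
  bounded-depth tautologies. `IsModDepthPolyBoundedOn F a d T` takes the class `T` as a
  parameter; `AC0pFregeIsPolyBounded p d` fixes the standard one, DNF tautologies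
  (`Set.range PropForm.ofDNF`, depth `≤ 3`), and quantifies existentially over the Frege rule
  set (all Frege systems p-simulate each other with `O(1)` depth increase, so
  `∀ d, ¬ AC0pFregeIsPolyBounded p d` is the robust form of "`AC⁰[p]`-Frege is not polynomially
  bounded", the open problem; for small `d` it holds for the trivial reason above).
* Mathlib has no propositional proof systems (searched `Frege`, `MOD`, `pSimulat`).
-/

namespace Literature.Computability.Complexity.PropForm

/-! ### DNF formulas -/

universe u

variable {ν : Type u}

/-- The formula of a clause list read as a DNF (disjunction of conjunctions of literals):
`⋁_c ⋀_{l ∈ c} l`, with the empty conjunction `const true` and the empty disjunction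
`const false`. Dual to `PropForm.ofCNF`. (Dot-extension of G01's `Literature.Computability.Complexity.PropForm`.)
[Arora–Barak 2009, §2.3 (CNF/DNF); Cook 1971, Thm 2 (DNF tautologies)] [cite: AroraBarak2009, §2.3] -/
def ofDNF (φ : CNF ν) : PropForm ν :=
  φ.foldr (fun c acc => disj (c.foldr (fun l d => conj
    (if l.2 then var l.1 else neg (var l.1)) d) (const true)) acc) (const false)

/-- `ofDNF` is semantically correct: its value is the DNF value `CNF.evalDNF`.
[Arora–Barak 2009, §2.3] [cite: AroraBarak2009, §2.3] -/
theorem eval_ofDNF (φ : CNF ν) (σ : ν → Bool) : (ofDNF φ).eval σ = φ.evalDNF σ := by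
  induction φ with
  | nil => rfl
  | cons c φ ih =>
    simp only [ofDNF, List.foldr_cons, eval, CNF.evalDNF, List.any_cons] at ih ⊢
    rw [ih]
    congr 1
    induction c with
    | nil => rfl
    | cons l c ihc =>
      simp only [List.foldr_cons, eval, List.all_cons] at ihc ⊢
      rw [ihc]
      congr 1
      rcases l with ⟨x, _ | _⟩ <;> simp [eval, Literal.eval]

/-- A clause list is a DNF tautology iff `ofDNF` of it is a tautology.
[Cook 1971, Thm 2] [cite: Cook1971, Thm 2] -/
theorem isTautology_ofDNF_iff (φ : CNF ν) : (ofDNF φ).IsTautology ↔ φ.IsDNFTautology := by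
  simp [IsTautology, CNF.IsDNFTautology, eval_ofDNF]

/-- DNF formulas have alternation depth at most `3` (a `∨`-block of `∧`-blocks of literals,
negative literals contributing one `¬`-block). [Krajíček 1995, §4.3] [folklore] -/
theorem altDepth_ofDNF_le (φ : CNF ν) : (ofDNF φ).altDepth ≤ 3 := by
  -- inner conjunctions: depth ≤ 1 below a `conj` parent, ≤ 2 below any other parent
  have hlit : ∀ (l : Literal ν) (t : ℕ),
      altDepthAux t (if l.2 then var l.1 else neg (var l.1) : PropForm ν) ≤ 1 := by
    rintro ⟨x, _ | _⟩ t
    · simp only [altDepthAux, Bool.false_eq_true, if_false, zero_add]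
      split_ifs <;> simp
    · simp [altDepthAux]
  have hconj : ∀ (c : Clause ν),
      altDepthAux 2 (c.foldr (fun l d => conj
        (if l.2 then var l.1 else neg (var l.1)) d) (const true) : PropForm ν) ≤ 1 := by
    intro c
    induction c with
    | nil => simp [altDepthAux]
    | cons l c ih =>
      simp only [List.foldr_cons, altDepthAux, if_true, add_zero, max_le_iff]
      exact ⟨hlit l 2, ih⟩
  have hconj' : ∀ (c : Clause ν),
      altDepthAux 3 (c.foldr (fun l d => conj
        (if l.2 then var l.1 else neg (var l.1)) d) (const true) : PropForm ν) ≤ 2 := by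
    intro c
    cases c with
    | nil => simp [altDepthAux]
    | cons l c =>
      have h1 := hlit l 2
      have h2 := hconj c
      simp only [List.foldr_cons, altDepthAux, Nat.reduceEqDiff, if_false]
      omega
  have hdisj : ∀ (φ : CNF ν), altDepthAux 3 (ofDNF φ) ≤ 2 := by
    intro φ
    induction φ with
    | nil => simp [ofDNF, altDepthAux]
    | cons c φ ih =>
      simp only [ofDNF, List.foldr_cons, altDepthAux, if_true, add_zero, max_le_iff] at ih ⊢
      exact ⟨hconj' c, ih⟩
  cases φ with
  | nil => simp [ofDNF, altDepth, altDepthAux]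
  | cons c φ =>
    have h1 := hconj' c
    have h2 := hdisj φ
    simp only [ofDNF, List.foldr_cons] at h2 ⊢
    simp only [altDepth, altDepthAux, Nat.reduceEqDiff, if_false]
    omega

end Literature.Computability.Complexity.PropForm

namespace Literature.Computability.MetaComplexity

open Complexity

universe u

/-! ### Formulas with `MOD_a` connectives -/

/-- Propositional formulas over variables `ν` in the basis `¬, ∧, ∨` with constants, extended by
the modular counting connectives `MOD_{a,i}` (`i ∈ ℤ/a`) of unbounded arity:
`modc i args` is `MOD_{a,i}(args 0, …, args (k-1))`, true iff the number of true arguments is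
`≡ i (mod a)`. [Buss–Impagliazzo–Krajíček–Pudlák–Razborov–Sgall 1997, Def. 1.1;
Krajíček 1995, §12.6] [cite: BussImpagliazzoKrajicekPudlakRazborovSgall1997, Def. 1.1] -/
inductive PropFormMod (a : ℕ) (ν : Type u) : Type u
  /-- a variable -/
  | var : ν → PropFormMod a ν
  /-- a truth constant `⊤`/`⊥` -/
  | const : Bool → PropFormMod a ν
  /-- negation -/
  | neg : PropFormMod a ν → PropFormMod a ν
  /-- conjunction -/
  | conj : PropFormMod a ν → PropFormMod a ν → PropFormMod a ν
  /-- disjunction -/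
  | disj : PropFormMod a ν → PropFormMod a ν → PropFormMod a ν
  /-- the modular counting gate `MOD_{a,i}(φ₀, …, φ_{k-1})` -/
  | modc {k : ℕ} : ZMod a → (Fin k → PropFormMod a ν) → PropFormMod a ν

namespace PropFormMod

variable {a : ℕ} {ν : Type u}

/-- The truth value of a formula under an assignment; `MOD_{a,i}(φ₀, …, φ_{k-1})` is true iff
`#{j : φ_j true} ≡ i (mod a)`. [Buss et al. 1997, Def. 1.1] [cite: BussImpagliazzoKrajicekPudlakRazborovSgall1997, Def. 1.1] -/
def eval (σ : ν → Bool) : PropFormMod a ν → Bool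
  | var x => σ x
  | const b => b
  | neg φ => !(eval σ φ)
  | conj φ ψ => eval σ φ && eval σ ψ
  | disj φ ψ => eval σ φ || eval σ ψ
  | modc i args => decide (((∑ j, (eval σ (args j)).toNat : ℕ) : ZMod a) = i)

/-- A formula is a tautology if it is true under every assignment.
[Buss et al. 1997, §1] [cite: BussImpagliazzoKrajicekPudlakRazborovSgall1997, §1] -/
def IsTautology (φ : PropFormMod a ν) : Prop :=
  ∀ σ : ν → Bool, φ.eval σ = true

/-- The size of a formula: number of nodes of its syntax tree (a `MOD` gate is one node).
[Buss et al. 1997, §1 (number of symbols)] [cite: BussImpagliazzoKrajicekPudlakRazborovSgall1997, §1] -/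
def size : PropFormMod a ν → ℕ
  | var _ => 1
  | const _ => 1
  | neg φ => size φ + 1
  | conj φ ψ => size φ + size ψ + 1
  | disj φ ψ => size φ + size ψ + 1
  | modc _ args => ∑ j, size (args j) + 1

/-- Simultaneous substitution of formulas for variables.
[Cook–Reckhow 1979, §2; Buss et al. 1997, §1 (axiom schemes)] [cite: CookReckhow1979, §2] -/
def subst (σ : ν → PropFormMod a ν) : PropFormMod a ν → PropFormMod a ν
  | var x => σ x
  | const b => const b
  | neg φ => neg (subst σ φ)
  | conj φ ψ => conj (subst σ φ) (subst σ ψ)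
  | disj φ ψ => disj (subst σ φ) (subst σ ψ)
  | modc i args => modc i fun j => subst σ (args j)

/-- Biimplication `φ ≡ ψ` as `(¬φ ∨ ψ) ∧ (φ ∨ ¬ψ)` (same shape as `PropForm.biimp`).
[Buss et al. 1997, §1 (`≡` as an abbreviation)] [cite: BussImpagliazzoKrajicekPudlakRazborovSgall1997, §1] -/
def biimp (φ ψ : PropFormMod a ν) : PropFormMod a ν :=
  conj (disj (neg φ) ψ) (disj φ (neg ψ))

/-- Auxiliary for `altDepth`: alternation depth below a parent with tag `c` (`1` = `neg`,
`2` = `conj`, `3` = `disj`, other = none/`MOD`); equal binary connectives nest in one block, a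
`MOD` gate always counts one and its arguments open new blocks (extends
`PropForm.altDepthAux`). [Buss et al. 1997, Def. 1.1 (depth); Krajíček 1995, §4.3] [cite: BussImpagliazzoKrajicekPudlakRazborovSgall1997, Def. 1.1] -/
def altDepthAux : ℕ → PropFormMod a ν → ℕ
  | _, var _ => 0
  | _, const _ => 0
  | c, neg φ => altDepthAux 1 φ + (if c = 1 then 0 else 1)
  | c, conj φ ψ => max (altDepthAux 2 φ) (altDepthAux 2 ψ) + (if c = 2 then 0 else 1)
  | c, disj φ ψ => max (altDepthAux 3 φ) (altDepthAux 3 ψ) + (if c = 3 then 0 else 1)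
  | _, modc _ args => (Finset.univ.sup fun j => altDepthAux 0 (args j)) + 1

/-- The (alternation) depth of a formula with `MOD` gates: as `PropForm.altDepth`, a `MOD`
gate adding one. [Buss et al. 1997, Def. 1.1 (depth(`MOD_{a,i}(ψ₁,…,ψ_k)`) = max depth(ψ_j) + 1);
Krajíček 1995, §4.3, §12.6] [cite: BussImpagliazzoKrajicekPudlakRazborovSgall1997, Def. 1.1] -/
def altDepth (φ : PropFormMod a ν) : ℕ :=
  altDepthAux 0 φ

/-- The embedding of `¬∧∨`-formulas into formulas with `MOD_a` gates.
[Buss et al. 1997, Def. 1.1 (the language of `F` extended by `MOD_{a,i}`)] [cite: BussImpagliazzoKrajicekPudlakRazborovSgall1997, Def. 1.1] -/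
def ofPropForm : PropForm ν → PropFormMod a ν
  | .var x => var x
  | .const b => const b
  | .neg φ => neg (ofPropForm φ)
  | .conj φ ψ => conj (ofPropForm φ) (ofPropForm ψ)
  | .disj φ ψ => disj (ofPropForm φ) (ofPropForm ψ)

/-- `IsModAxiom θ`: `θ` is an instance of one of the `MOD_a` axioms:
1. `MOD_{a,0}(∅)`; 2. `¬MOD_{a,i}(∅)` for `i ≠ 0`;
3. `MOD_{a,i}(ψ₀,…,ψ_{k-1},φ) ≡ [(MOD_{a,i}(ψ₀,…,ψ_{k-1}) ∧ ¬φ) ∨ (MOD_{a,i-1}(ψ₀,…,ψ_{k-1}) ∧ φ)]`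
for `i ∈ ℤ/a`, `k ≥ 0` (`i - 1` modulo `a`). [Buss et al. 1997, Def. 1.1 (the `MOD_a` axioms);
Krajíček 1995, §12.6] [cite: BussImpagliazzoKrajicekPudlakRazborovSgall1997, Def. 1.1] -/
def IsModAxiom (θ : PropFormMod a ν) : Prop :=
  θ = modc (0 : ZMod a) ![] ∨
  (∃ i : ZMod a, i ≠ 0 ∧ θ = neg (modc i ![])) ∨
  (∃ (i : ZMod a) (k : ℕ) (ψ : Fin k → PropFormMod a ν) (φ : PropFormMod a ν),
    θ = biimp (modc i (Fin.snoc (α := fun _ => PropFormMod a ν) ψ φ))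
      (disj (conj (modc i ψ) (neg φ)) (conj (modc (i - 1) ψ) φ)))

/-! #### Basic API -/

/-- Semantics of biimplication. [Buss et al. 1997, §1] [cite: BussImpagliazzoKrajicekPudlakRazborovSgall1997, §1] -/
@[simp] theorem eval_biimp (σ : ν → Bool) (φ ψ : PropFormMod a ν) :
    (biimp φ ψ).eval σ = (φ.eval σ == ψ.eval σ) := by
  cases h₁ : φ.eval σ <;> cases h₂ : ψ.eval σ <;> simp [biimp, eval, h₁, h₂]

/-- Substitution commutes with evaluation. [Cook–Reckhow 1979, §2] [cite: CookReckhow1979, §2] -/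
@[simp] theorem eval_subst (σ : ν → PropFormMod a ν) (τ : ν → Bool) (φ : PropFormMod a ν) :
    (φ.subst σ).eval τ = φ.eval fun x => (σ x).eval τ := by
  induction φ <;> simp_all [subst, eval]

/-- The embedding preserves truth values. [Buss et al. 1997, Def. 1.1] [cite: BussImpagliazzoKrajicekPudlakRazborovSgall1997, Def. 1.1] -/
@[simp] theorem eval_ofPropForm (σ : ν → Bool) (φ : PropForm ν) :
    (ofPropForm φ : PropFormMod a ν).eval σ = φ.eval σ := by
  induction φ <;> simp_all [ofPropForm, eval, PropForm.eval]

/-- A `¬∧∨`-formula is a tautology in the extended language iff it is one.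
[Buss et al. 1997, Def. 1.1] [cite: BussImpagliazzoKrajicekPudlakRazborovSgall1997, Def. 1.1] -/
theorem isTautology_ofPropForm_iff (φ : PropForm ν) :
    (ofPropForm φ : PropFormMod a ν).IsTautology ↔ φ.IsTautology := by
  simp [IsTautology, PropForm.IsTautology]

/-- The embedding preserves size. [Buss et al. 1997, §1] [cite: BussImpagliazzoKrajicekPudlakRazborovSgall1997, §1] -/
@[simp] theorem size_ofPropForm (φ : PropForm ν) :
    (ofPropForm φ : PropFormMod a ν).size = φ.size := by
  induction φ <;> simp_all [ofPropForm, size, PropForm.size]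

/-- The embedding preserves the auxiliary depth. [Krajíček 1995, §4.3] [folklore] -/
theorem altDepthAux_ofPropForm (c : ℕ) (φ : PropForm ν) :
    altDepthAux c (ofPropForm φ : PropFormMod a ν) = PropForm.altDepthAux c φ := by
  induction φ generalizing c <;> simp_all [ofPropForm, altDepthAux, PropForm.altDepthAux]

/-- The embedding preserves depth. [Buss et al. 1997, Def. 1.1; Krajíček 1995, §4.3] [folklore] -/
@[simp] theorem altDepth_ofPropForm (φ : PropForm ν) :
    (ofPropForm φ : PropFormMod a ν).altDepth = φ.altDepth :=
  altDepthAux_ofPropForm 0 φ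

/-- The embedding commutes with substitution. [Cook–Reckhow 1979, §2] [folklore] -/
theorem ofPropForm_subst (σ : ν → PropForm ν) (φ : PropForm ν) :
    (ofPropForm (φ.subst σ) : PropFormMod a ν) = (ofPropForm φ).subst fun x => ofPropForm (σ x) := by
  induction φ <;> simp_all [ofPropForm, subst, PropForm.subst]

/-- **The `MOD_a` axioms are tautologies** (so `F(MOD_a)` is sound for sound `F`).
[Buss et al. 1997, Def. 1.1 ("intuitive meaning" of `MOD_{a,i}`)] [cite: BussImpagliazzoKrajicekPudlakRazborovSgall1997, Def. 1.1] -/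
theorem IsModAxiom.isTautology {θ : PropFormMod a ν} (h : IsModAxiom θ) : θ.IsTautology := by
  intro σ
  rcases h with rfl | ⟨i, hi, rfl⟩ | ⟨i, k, ψ, φ, rfl⟩
  · simp [eval]
  · simpa [eval] using Ne.symm hi
  · rw [eval_biimp]
    simp only [eval, Fin.sum_univ_castSucc, Fin.snoc_castSucc, Fin.snoc_last, Nat.cast_add]
    cases eval σ φ <;> simp [eq_sub_iff_add_eq]

end PropFormMod

/-! ### `F(MOD_a)`-derivations over a Frege system `F` -/

namespace FregeSystem

variable (F : FregeSystem) {a : ℕ}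

/-- `F.IsModInferred prev θ`: `θ` follows from earlier lines `prev` by one application of a rule
of `F`, its metavariables instantiated by formulas with `MOD_a` gates.
[Buss et al. 1997, Def. 1.1 (`F(MOD_a)` = `F` in the extended language + `MOD_a` axioms);
Cook–Reckhow 1979, §2] [cite: BussImpagliazzoKrajicekPudlakRazborovSgall1997, Def. 1.1] -/
def IsModInferred (prev : List (PropFormMod a ℕ)) (θ : PropFormMod a ℕ) : Prop :=
  ∃ r ∈ F.rules, ∃ σ : ℕ → PropFormMod a ℕ,
    (PropFormMod.ofPropForm r.conclusion).subst σ = θ ∧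
    ∀ q ∈ r.premises, (PropFormMod.ofPropForm q).subst σ ∈ prev

/-- `F.IsModDerivation Γ π`: `π` is an `F(MOD_a)`-derivation from hypotheses `Γ` — every line is
a hypothesis, a `MOD_a` axiom, or inferred by a rule of `F` from earlier lines.
[Buss et al. 1997, Def. 1.1; Krajíček 1995, §12.6] [cite: BussImpagliazzoKrajicekPudlakRazborovSgall1997, Def. 1.1] -/
def IsModDerivation (Γ : Set (PropFormMod a ℕ)) (π : List (PropFormMod a ℕ)) : Prop :=
  ∀ (k : ℕ) (hk : k < π.length),
    π[k] ∈ Γ ∨ PropFormMod.IsModAxiom π[k] ∨ F.IsModInferred (π.take k) π[k]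

/-- `F.IsModProofOf π φ`: `π` is an `F(MOD_a)`-proof of `φ` (no hypotheses, last line `φ`).
[Buss et al. 1997, Def. 1.1] [cite: BussImpagliazzoKrajicekPudlakRazborovSgall1997, Def. 1.1] -/
def IsModProofOf (π : List (PropFormMod a ℕ)) (φ : PropFormMod a ℕ) : Prop :=
  F.IsModDerivation ∅ π ∧ π.getLast? = some φ

/-- `F.IsModDepthProofOf d π φ`: `π` is an `F_d(MOD_a)`-proof of `φ` — an `F(MOD_a)`-proof all
of whose lines have depth `≤ d` ("the depth of a proof is the maximal depth of formulas
appearing in the proof"). [Buss et al. 1997, Def. 1.1; Krajíček 1995, §12.6] [cite: BussImpagliazzoKrajicekPudlakRazborovSgall1997, Def. 1.1] -/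
def IsModDepthProofOf (d : ℕ) (π : List (PropFormMod a ℕ)) (φ : PropFormMod a ℕ) : Prop :=
  F.IsModProofOf π φ ∧ ∀ ψ ∈ π, ψ.altDepth ≤ d

end FregeSystem

/-- The size (symbol count) of an `F(MOD_a)`-derivation: the sum of the sizes of its lines.
[Buss et al. 1997, §1 (number of symbols vs. number of inferences); Cook–Reckhow 1979, §2] [cite: BussImpagliazzoKrajicekPudlakRazborovSgall1997, §1] -/
def modProofSize {a : ℕ} (π : List (PropFormMod a ℕ)) : ℕ :=
  (π.map PropFormMod.size).sum

/-- `F.IsModDepthPolyBoundedOn a d T`: the depth-`d` system `F_d(MOD_a)` is *polynomially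
bounded on the target class* `T` of `¬∧∨`-formulas — there is a polynomial `q` such that every
tautology `φ ∈ T` has an `F_d(MOD_a)`-proof of size `≤ q(φ.size)`. (Lower bounds in print have
the form `¬ F.IsModDepthPolyBoundedOn p d T` for all `d`, with `T` a family of constant-depth
tautologies such as `Count_q^N` or `¬PHP`.) [Buss et al. 1997, §1 (length-of-proofs function of
bounded depth Frege with `MOD_p` gates), Def. 1.1; Cook–Reckhow 1979, §1 (polynomially bounded)] [cite: BussImpagliazzoKrajicekPudlakRazborovSgall1997, §1] -/
def FregeSystem.IsModDepthPolyBoundedOn (F : FregeSystem) (a d : ℕ) (T : Set (PropForm ℕ)) :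
    Prop :=
  ∃ q : Polynomial ℕ, ∀ φ ∈ T, φ.IsTautology →
    ∃ π : List (PropFormMod a ℕ),
      F.IsModDepthProofOf d π (PropFormMod.ofPropForm φ) ∧ modProofSize π ≤ q.eval φ.size

/-- `AC0pFregeIsPolyBounded p d`: depth-`d` Frege with `MOD_p` gates is polynomially bounded (as
a proof system for DNF tautologies) — for some Frege system `F` (sound, implicationally
complete schematic rules), every DNF tautology `PropForm.ofDNF C` has an `F_d(MOD_p)`-proof of
size polynomial in its size. The open problem "superpolynomial lower bounds for
`AC⁰[p]`-Frege" (`p` prime) is `∀ d, ¬ AC0pFregeIsPolyBounded p d`; for `d` below the depth of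
the target DNFs it holds trivially. The choice of `F` is immaterial up to an additive constant
in `d` (Frege systems p-simulate each other with constant depth increase).
[Buss et al. 1997, §1 and Def. 1.1 (bounded depth Frege with `MOD_p` gates; no lower bounds
known); Krajíček 1995, §12.6] [cite: BussImpagliazzoKrajicekPudlakRazborovSgall1997, Def. 1.1] -/
def AC0pFregeIsPolyBounded (p d : ℕ) : Prop :=
  ∃ F : FregeSystem, IsFrege F ∧ F.IsModDepthPolyBoundedOn p d (Set.range PropForm.ofDNF)

/-! ### API -/

namespace FregeSystem

variable {F : FregeSystem} {a : ℕ} {Γ : Set (PropFormMod a ℕ)} {π : List (PropFormMod a ℕ)}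
  {φ : PropFormMod a ℕ}

/-- The empty sequence is an `F(MOD_a)`-derivation. [Cook–Reckhow 1979, §2] [folklore] -/
theorem isModDerivation_nil (F : FregeSystem) (Γ : Set (PropFormMod a ℕ)) :
    F.IsModDerivation Γ [] :=
  fun k hk => absurd hk (Nat.not_lt_zero k)

/-- **Soundness of `F(MOD_a)`-derivations**: for sound `F`, every line of a derivation from `Γ`
is a semantic consequence of `Γ` (rule instances are sound under `MOD`-substitutions by
`eval_subst`/`eval_ofPropForm`; `MOD_a` axioms by `IsModAxiom.isTautology`).
[Buss et al. 1997, Def. 1.1; Cook–Reckhow 1979, §2 (soundness)] [folklore] -/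
theorem IsSound.eval_of_isModDerivation (hF : F.IsSound) (h : F.IsModDerivation Γ π)
    (τ : ℕ → Bool) (hΓ : ∀ ψ ∈ Γ, ψ.eval τ = true) : ∀ ψ ∈ π, ψ.eval τ = true := by
  suffices H : ∀ (k : ℕ) (hk : k < π.length), π[k].eval τ = true by
    intro ψ hψ
    obtain ⟨k, hk, rfl⟩ := List.getElem_of_mem hψ
    exact H k hk
  intro k
  induction k using Nat.strong_induction_on with
  | _ k ih =>
    intro hk
    rcases h k hk with hm | hax | ⟨r, hr, σ, hconc, hprem⟩
    · exact hΓ _ hm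
    · exact hax.isTautology τ
    · rw [← hconc, PropFormMod.eval_subst, PropFormMod.eval_ofPropForm]
      refine hF r hr _ fun q hq => ?_
      obtain ⟨j, hj, hj'⟩ := List.getElem_of_mem (hprem q hq)
      rw [List.length_take] at hj
      have := ih j (by omega) (by omega)
      rw [List.getElem_take] at hj'
      rwa [hj', PropFormMod.eval_subst, PropFormMod.eval_ofPropForm] at this

/-- **Soundness**: a formula with an `F(MOD_a)`-proof over a sound `F` is a tautology.
[Buss et al. 1997, Def. 1.1; Cook–Reckhow 1979, §2] [folklore] -/
theorem IsSound.isTautology_of_isModProofOf (hF : F.IsSound) (h : F.IsModProofOf π φ) :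
    φ.IsTautology := fun τ =>
  hF.eval_of_isModDerivation h.1 τ (fun ψ hψ => absurd hψ (Set.notMem_empty ψ)) φ
    (List.mem_of_getLast? h.2)

/-- An `F`-proof, read in the extended language, is an `F(MOD_a)`-proof (using no `MOD_a`
axioms). [Buss et al. 1997, Def. 1.1 (`F(MOD_a)` extends `F`)] [folklore] -/
theorem IsProofOf.isModProofOf_map {π : List (PropForm ℕ)} {φ : PropForm ℕ}
    (h : F.IsProofOf π φ) :
    F.IsModProofOf (a := a) (π.map PropFormMod.ofPropForm) (PropFormMod.ofPropForm φ) := by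
  refine ⟨fun k hk => ?_, by rw [List.getLast?_map, h.2]; rfl⟩
  rw [List.length_map] at hk
  rcases h.1 k hk with hm | ⟨r, hr, σ, hconc, hprem⟩
  · exact absurd hm (Set.notMem_empty _)
  · refine Or.inr (Or.inr ⟨r, hr, fun x => PropFormMod.ofPropForm (σ x), ?_, fun q hq => ?_⟩)
    · rw [List.getElem_map, ← hconc, PropFormMod.ofPropForm_subst]
    · rw [← List.map_take, ← PropFormMod.ofPropForm_subst]
      exact List.mem_map_of_mem (hprem q hq)

/-- A depth-`d` `F`-proof is a depth-`d` `F(MOD_a)`-proof. [Buss et al. 1997, Def. 1.1] [folklore] -/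
theorem IsDepthProofOf.isModDepthProofOf_map {d : ℕ} {π : List (PropForm ℕ)} {φ : PropForm ℕ}
    (h : F.IsDepthProofOf d π φ) :
    F.IsModDepthProofOf (a := a) d (π.map PropFormMod.ofPropForm) (PropFormMod.ofPropForm φ) := by
  refine ⟨h.1.isModProofOf_map, fun ψ hψ => ?_⟩
  obtain ⟨χ, hχ, rfl⟩ := List.mem_map.1 hψ
  rw [PropFormMod.altDepth_ofPropForm]
  exact h.2 χ hχ

/-- The size of an embedded proof is unchanged. [Buss et al. 1997, §1] [folklore] -/
@[simp] theorem _root_.Literature.Computability.MetaComplexity.modProofSize_map_ofPropForm (π : List (PropForm ℕ)) :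
    modProofSize (a := a) (π.map PropFormMod.ofPropForm) = proofSize π := by
  simp [modProofSize, proofSize, List.map_map, Function.comp_def]

/-- Monotonicity of `IsModDepthPolyBoundedOn` in the depth and (contravariantly) in the target
class. [Buss et al. 1997, §1] [folklore] -/
theorem IsModDepthPolyBoundedOn.mono {d d' : ℕ} {T T' : Set (PropForm ℕ)}
    (h : F.IsModDepthPolyBoundedOn a d T) (hd : d ≤ d') (hT : T' ⊆ T) :
    F.IsModDepthPolyBoundedOn a d' T' := by
  obtain ⟨q, hq⟩ := h
  refine ⟨q, fun φ hφ hφt => ?_⟩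
  obtain ⟨π, ⟨hπ, hdepth⟩, hsize⟩ := hq φ (hT hφ) hφt
  exact ⟨π, ⟨hπ, fun ψ hψ => (hdepth ψ hψ).trans hd⟩, hsize⟩

end FregeSystem

/-- `AC0pFregeIsPolyBounded p d` is monotone in `d`. [Buss et al. 1997, §1] [folklore] -/
theorem AC0pFregeIsPolyBounded.mono {p d d' : ℕ} (h : AC0pFregeIsPolyBounded p d) (hd : d ≤ d') :
    AC0pFregeIsPolyBounded p d' := by
  obtain ⟨F, hF, hb⟩ := h
  exact ⟨F, hF, hb.mono hd le_rfl⟩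

end Literature.Computability.MetaComplexity
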